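import Literature.Probability.Percolation.ParaPivotalSumBounds
import HarnessLib

/-!
# The pivotal count of the rhombus crossing below `L(p)` from Werner's near-critical facts (proofs only)

Topic `Literature/Probability/Percolation`; family `crit-perc`, statement **crit-perc.S16**
(`Literature.Probability.Percolation.triTheta_exponent`). Proofs only (no new definition, no new
named fact). Sibling of `ParaPivotalSumBounds.lean` (W. Werner, PCMI 2009, Lecture 6, Lemma 6.2 for
the `2N × N` parallelogram) for the RHOMBUS `[0, N]²` and Nolin's characteristic length, i.e. for
the named fact `Werner2009_lemma62` of `KestenRelationRusso.lean`:
`Σ_{v ∈ [0,N]²} P_t(v pivotal for 𝒞_H([0,N]²)) ≍ N² π₄(N)` for `|t - 1/2| < δ`, `n₁ ≤ N ≤ L_ε(t)`,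
every `ε ∈ (0, 1/2)`, with the CRITICAL four-arm probability `π₄(N) = critFourArmProb r₀ N`
(Werner, Lemma 6.2 combined with Lemma 6.3; P. Nolin, *Electron. J. Probab.* 13 (2008), proof of
Prop. 34 and Remark 35 [arXiv 0711.4948: Prop. 32, Remark 34]).

What is PROVED here.

* **Upper bound, from four named facts of the tree** (`rhombusPivotalSum_upper_of_facts`):
  `Werner2009_lemma63` (four-arm stability below `L(p)`, Lemma 6.3), `Werner2009_fourArm_quasiMult`
  (Cor. 6.2), `Werner2009_fourArm_lowerBound` (§3) and `Werner2009_halfPlane_twoArm` (§3 ¶1) imply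
  `Σ_{v ∈ [0,N]²} P_t(v pivotal) ≤ C N² π₄(N)` in the conventions of `Werner2009_lemma62` (every
  `ε ∈ (0, 1/2)`, both sides of `1/2`, Nolin's `L_ε = charLength ε`). The per-site envelope of
  `ParaPivotalSumBounds.lean` (shallow rows / layer / bulk through the distance to the nearest side,
  Werner's proof of the upper bound of Lemma 6.2) is redone for a parallelogram `R(m, N)` at least as
  wide as tall (`wide_site_envelope_le`; the rhombus is `m = N`) and summed over the rhombus
  (`rhombusPivotalSum_upper_W`); then three bridges recorded in the tree convert Werner's conventions
  into Nolin's: `L_ε(t) ≤ L_{ε'}(t)` for `ε' ≤ ε` (`charLength_anti`: facts "for small `ε`" serve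
  every `ε`), `L_{ε'}(t) ≤ L(t, ε')` (`charLength_le_charLengthW`: Nolin's rhombus length is below
  Werner's), and `rhombusPivotalSum (1 - t) N = rhombusPivotalSum t N` (`rhombusPivotalSum_symm`:
  facts for `t ≥ 1/2` serve `|t - 1/2| < δ`); `π̂_t(r₀, N) ≤ C π₄(N)` is `Werner2009_lemma63`.
* **Lower bound, from a pointwise interior bound** (`rhombusPivotalSum_lower_of_forall`, pure
  counting: the `≥ N²/64` sites at distance more than `N/4` from the boundary), and the resulting
  **assembly** `Werner2009_lemma62_of_facts`: the four facts above together with the rhombus form of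
  the tree's `Werner2009_pivotal_lowerBound` — "each site of `[0, N]²` at distance more than `N/4`
  from its boundary is pivotal for `𝒞_H([0,N]²)` with probability `≥ cst π̂_t(r₀, N)`, uniformly
  below `L(p)`" (Nolin 2008, proof of Prop. 34, last display:
  `P̂(v ⇝^{4,σ₄,Ī} ∂[0, L]²) ≍ P̂(v ⇝^{4,σ₄} ∂S_{ηL}(v)) ≍ P_{1/2}(0 ⇝^{4,σ₄} ∂S_L)`; Werner, proof of
  Lemma 6.2, lower bound, for the parallelogram) — imply `Werner2009_lemma62`. That pointwise lower
  bound rests on the near-critical separation and extendability of four arms (Nolin Thm. 11,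
  Props. 12–13; Werner §4, Prop. 6.1) and is NOT in the tree for the rhombus (the tree records it
  for the `2N × N` parallelogram only, `Werner2009_pivotal_lowerBound`, `NearCriticalBoundaryFacts.lean`);
  by D-0026 it is not introduced here as a named fact but enters `Werner2009_lemma62_of_facts` as
  an explicit hypothesis, spelled exactly like `Werner2009_pivotal_lowerBound` with `R(2N, N)`
  replaced by `R(N, N)`. (Pivotality for the crossing of a parallelogram and of the rhombus
  containing or contained in it are not comparable as events, and the Harris–FKG inequality gives
  no lower bound for the intersection of the increasing and decreasing halves of a four-arm event,
  so the rhombus bound does not follow formally from the parallelogram one.)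

## References

* W. Werner, *Lectures on two-dimensional critical percolation*, IAS/Park City Math. Ser. 16
  (2009), Lecture 6, §3, Cor. 6.2, Lemma 6.2 (proof), Lemma 6.3 [WernerPCMI2009].
* P. Nolin, Near-critical percolation in two dimensions, *Electron. J. Probab.* 13 (2008), §7.3,
  Prop. 34 (proof) and Remark 35; Cor. 35 [arXiv 0711.4948: Prop. 32, Remark 34, Cor. 33] [Nolin2008].
* H. Kesten, Scaling relations for 2D-percolation, *Comm. Math. Phys.* 109 (1987)
  [KestenScalingCMP1987].

Tree: `para_pivotal_three_le`, `para_pivotal_two_le` (`ParaPivotalBoundary.lean`),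
`measureReal_isPivotal_triLRCrossing_le_fourArmProbAt` (`ParaPivotalArms.lean`),
`fourArmProbAt_le_ratio_mul` (`OneArmPivotalSum.lean`), `sum_rectangle_le_envelope`,
`sum_layer_envelope_le`, `sum_shallow_envelope_le`, `mkSite_injective` (`ParaPivotalSumBounds.lean`),
`charLength_le_charLengthW` (`WernerCorrelationLengthProofs.lean`), `charLength_anti`,
`rhombusPivotalSum_symm`, `Werner2009_lemma62_of_half_le` (`KestenRelationRussoProofs.lean`),
`Nolin2008_subcritical_crossing_holds` (`NearCriticalRSW.lean`).
-/

noncomputable section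

open MeasureTheory Set Finset Real

namespace Literature.Probability.Percolation

open LatticeModels
open scoped unitInterval

/-! ### The per-site envelope for a parallelogram at least as wide as tall -/

/-- **The per-site bound through the distance to the nearest side, for `R(m, N)` with `N ≤ m`**
(the rhombus is `m = N`, Werner's parallelogram `m = 2N`): the three regimes of
`para_site_envelope_le` (`ParaPivotalSumBounds.lean`) — shallow rows `d < i₀` by `para_pivotal_two_le`
and the half-plane bound; layer `i₀ ≤ d`, `6d + 5 ≤ N` by `para_pivotal_three_le`, the ratio bound
and the half-plane bound; bulk by the local four arms and the ratio bound — with the three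
near-critical facts instantiated at `t` and radii `≤ N` as hypotheses. The proof is that of
`para_site_envelope_le` verbatim, the width entering only through `max (v₀, m - v₀) ≥ N/2`. [cite: WernerPCMI2009, Lecture 6, proof of Lemma 6.2 (upper bound)] -/
theorem wide_site_envelope_le {t : unitInterval} {m N r₀ rL n₀ i₀ : ℕ} {cQ cL CH β πN K Bc S : ℝ}
    (hm : N ≤ m) (hcQ : 0 < cQ) (hcL : 0 < cL) (hβ : 0 < β) (hβ2 : β ≤ 2) (hCH0 : 0 ≤ CH)
    (hr1 : 1 ≤ r₀) (hi₀ : i₀ = 4 * r₀ + 1 + rL + n₀ + 1) (hN8 : 8000 ≤ N) (hNi : 40 * i₀ ≤ N)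
    (hQt : ∀ R S : ℕ, 16 * r₀ < 4 * R → 4 * R < S → S ≤ N →
      cQ * (fourArmProbAt t r₀ R * fourArmProbAt t (4 * R) S) ≤ fourArmProbAt t r₀ S)
    (hLt : ∀ m n : ℕ, rL ≤ m → m ≤ n → n ≤ N → cL * ((m : ℝ) / n) ^ (2 - β) ≤ fourArmProbAt t m n)
    (hHt : ∀ m n : ℕ, n₀ ≤ m → m ≤ n → n ≤ N →
      (triSitePercolation t).real (domArmEvent ![true, false] m n upperHalfPlane) ≤ CH * ((m : ℝ) / n))
    (hπNdef : πN = fourArmProbAt t r₀ N) (hK : K = 36 * CH / (cQ * cL)) (hBc : Bc = 196 / (cQ * cL))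
    (hSdef : S = 3 * CH * (n₀ + 1 + i₀) / N) (v : Site 2) (d : ℕ)
    (hd : (d : ℤ) = v 0 ∨ (d : ℤ) = (m : ℕ) - v 0 ∨ (d : ℤ) = v 1 ∨ (d : ℤ) = (N : ℕ) - v 1)
    (h0 : (d : ℤ) ≤ v 0) (h0' : v 0 + d ≤ (m : ℕ)) (h1 : (d : ℤ) ≤ v 1) (h1' : v 1 + d ≤ (N : ℕ)) :
    (triSitePercolation t).real {ω | IsPivotal (triLRCrossing m N) v ω} ≤
      (if d < i₀ then S else 0) + K * (((N : ℝ) / d) ^ (2 - β) * ((d : ℝ) / N)) * πN + Bc * πN := by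
  have hN0 : (0 : ℝ) < N := by exact_mod_cast (show 0 < N by omega)
  have hπN0 : 0 ≤ πN := by rw [hπNdef]; exact fourArmProbAt_nonneg t r₀ N
  have hS0 : 0 ≤ S := by rw [hSdef]; positivity
  have hK0 : 0 ≤ K := by rw [hK]; positivity
  have hBc0 : 0 ≤ Bc := by rw [hBc]; positivity
  have hR0 : ((N / 2 : ℕ) : ℤ) ≤ max (v 0) ((m : ℕ) - v 0) := by
    rw [le_max_iff]; push_cast; omega
  have hR1 : ((N / 2 : ℕ) : ℤ) ≤ max (v 1) ((N : ℕ) - v 1) := by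
    rw [le_max_iff]; push_cast; omega
  have hdN : 2 * d ≤ N := by
    have : (2 * (d : ℤ)) ≤ N := by omega
    exact_mod_cast this
  rcases lt_or_ge d i₀ with hdi | hdi
  · -- shallow: two factors
    have h2 := para_pivotal_two_le t (m := m) (n := N) (i := d) (r' := n₀ + 1) (R₂ := N / 2)
      hd (by omega) (by omega) hR0 hR1
    have hh := hHt (n₀ + 1 + d) (N / 2 - d) (by omega) (by omega) (by omega)
    have hrat : ((n₀ + 1 + d : ℕ) : ℝ) / ((N / 2 - d : ℕ) : ℝ) ≤ 3 * ((n₀ : ℝ) + 1 + i₀) / N := by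
      have hden : (0 : ℝ) < ((N / 2 - d : ℕ) : ℝ) := by exact_mod_cast (show 0 < N / 2 - d by omega)
      rw [div_le_div_iff₀ hden hN0]
      have key : (n₀ + 1 + d) * N ≤ 3 * (n₀ + 1 + i₀) * (N / 2 - d) := by
        have h5 : 2 * (N / 2) + 1 ≥ N := by omega
        have : (n₀ + 1 + d) * N ≤ (n₀ + 1 + i₀) * N := Nat.mul_le_mul_right _ (by omega)
        have : 3 * (n₀ + 1 + i₀) * (N / 2 - d) ≥ (n₀ + 1 + i₀) * N := by
          have : 3 * (N / 2 - d) ≥ N := by omega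
          calc 3 * (n₀ + 1 + i₀) * (N / 2 - d) = (n₀ + 1 + i₀) * (3 * (N / 2 - d)) := by ring
            _ ≥ (n₀ + 1 + i₀) * N := Nat.mul_le_mul_left _ this
        omega
      have : (((n₀ + 1 + d) * N : ℕ) : ℝ) ≤ ((3 * (n₀ + 1 + i₀) * (N / 2 - d) : ℕ) : ℝ) := by
        exact_mod_cast key
      push_cast at this ⊢
      linarith
    have hψd : S ≤ (if d < i₀ then S else 0) + K * (((N : ℝ) / d) ^ (2 - β) * ((d : ℝ) / N)) * πN + Bc * πN := by
      rw [if_pos hdi]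
      have : 0 ≤ K * (((N : ℝ) / d) ^ (2 - β) * ((d : ℝ) / N)) * πN := by positivity
      have : 0 ≤ Bc * πN := by positivity
      linarith
    refine le_trans ?_ hψd
    calc (triSitePercolation t).real {ω | IsPivotal (triLRCrossing m N) v ω}
        ≤ (triSitePercolation t).real
            (domArmEvent ![true, false] (n₀ + 1 + d) (N / 2 - d) upperHalfPlane) := h2
      _ ≤ CH * (((n₀ + 1 + d : ℕ) : ℝ) / ((N / 2 - d : ℕ) : ℝ)) := hh
      _ ≤ CH * (3 * ((n₀ : ℝ) + 1 + i₀) / N) := mul_le_mul_of_nonneg_left hrat hCH0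
      _ = S := by rw [hSdef]; ring
  rcases le_or_gt (6 * d + 5) N with hdl | hdl
  · -- layer: three factors
    have h3 := para_pivotal_three_le t (m := m) (n := N) (i := d) (r' := d + 1) (R₂ := N / 2)
      (r₀ := r₀) hd h0 h0' h1 h1' hr1 (by omega) le_rfl (by omega) hR0 hR1
    have hπ := fourArmProbAt_le_ratio_mul hcQ hcL hβ hβ2 hQt hLt (by omega) (by omega)
      (d := d) (by omega) (by omega) (by omega)
    rw [← hπNdef] at hπ
    have hh := hHt (d + 1 + d) (N / 2 - d) (by omega) (by omega) (by omega)
    have hrat : ((d + 1 + d : ℕ) : ℝ) / ((N / 2 - d : ℕ) : ℝ) ≤ 9 * ((d : ℝ) / N) := by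
      have hden : (0 : ℝ) < ((N / 2 - d : ℕ) : ℝ) := by exact_mod_cast (show 0 < N / 2 - d by omega)
      rw [mul_div_assoc', div_le_div_iff₀ hden hN0]
      have key : (d + 1 + d) * N ≤ 9 * d * (N / 2 - d) := by
        have hd1 : 1 ≤ d := by omega
        have h5 : 2 * (N / 2) + 1 ≥ N := by omega
        zify [show d ≤ N / 2 by omega] at h5 ⊢
        have hN2 : ((N / 2 : ℕ) : ℤ) ≥ 0 := by positivity
        nlinarith
      have : (((d + 1 + d) * N : ℕ) : ℝ) ≤ ((9 * d * (N / 2 - d) : ℕ) : ℝ) := by exact_mod_cast key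
      push_cast at this ⊢
      linarith
    have hψd : K * (((N : ℝ) / d) ^ (2 - β) * ((d : ℝ) / N)) * πN ≤
        (if d < i₀ then S else 0) + K * (((N : ℝ) / d) ^ (2 - β) * ((d : ℝ) / N)) * πN + Bc * πN := by
      have : 0 ≤ (if d < i₀ then S else 0) := by split_ifs <;> linarith
      have : 0 ≤ Bc * πN := by positivity
      linarith
    refine le_trans ?_ hψd
    have hX0 : (0 : ℝ) ≤ ((N : ℝ) / d) ^ (2 - β) := by positivity
    generalize ((N : ℝ) / d) ^ (2 - β) = X at hπ hX0 ⊢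
    calc (triSitePercolation t).real {ω | IsPivotal (triLRCrossing m N) v ω}
        ≤ fourArmProbAt t r₀ d * (triSitePercolation t).real
            (domArmEvent ![true, false] (d + 1 + d) (N / 2 - d) upperHalfPlane) := h3
      _ ≤ (4 / (cQ * cL) * X * πN) * (CH * (9 * ((d : ℝ) / N))) :=
          mul_le_mul hπ (hh.trans (mul_le_mul_of_nonneg_left hrat hCH0)) measureReal_nonneg
            (by positivity)
      _ = K * (X * ((d : ℝ) / N)) * πN := by rw [hK]; field_simp; ring
  · -- bulk: the local four arms only
    have hb := measureReal_isPivotal_triLRCrossing_le_fourArmProbAt t (m := m) (n := N)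
      (d := d) (v := v) hr1 (by omega) h0 h0' h1 h1'
    have hπ := fourArmProbAt_le_ratio_mul hcQ hcL hβ hβ2 hQt hLt (by omega) (by omega)
      (d := d) (by omega) (by omega) (by omega)
    rw [← hπNdef] at hπ
    have hd0 : (0 : ℝ) < d := by exact_mod_cast (show 0 < d by omega)
    have hNd : (1 : ℝ) ≤ (N : ℝ) / d := by
      rw [le_div_iff₀ hd0, one_mul]; exact_mod_cast (show d ≤ N by omega)
    have hNd7 : (N : ℝ) / d ≤ 7 := by
      rw [div_le_iff₀ hd0]; exact_mod_cast (show N ≤ 7 * d by omega)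
    have hX : ((N : ℝ) / d) ^ (2 - β) ≤ 49 := by
      calc ((N : ℝ) / d) ^ (2 - β) ≤ ((N : ℝ) / d) ^ (2 : ℝ) :=
            Real.rpow_le_rpow_of_exponent_le hNd (by linarith)
        _ = ((N : ℝ) / d) ^ 2 := Real.rpow_two _
        _ ≤ 7 ^ 2 := pow_le_pow_left₀ (by positivity) hNd7 2
        _ = 49 := by norm_num
    have hψd : Bc * πN ≤
        (if d < i₀ then S else 0) + K * (((N : ℝ) / d) ^ (2 - β) * ((d : ℝ) / N)) * πN + Bc * πN := by
      have : 0 ≤ (if d < i₀ then S else 0) := by split_ifs <;> linarith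
      have : 0 ≤ K * (((N : ℝ) / d) ^ (2 - β) * ((d : ℝ) / N)) * πN := by positivity
      linarith
    refine le_trans ?_ hψd
    calc (triSitePercolation t).real {ω | IsPivotal (triLRCrossing m N) v ω}
        ≤ fourArmProbAt t r₀ d := hb
      _ ≤ 4 / (cQ * cL) * ((N : ℝ) / d) ^ (2 - β) * πN := hπ
      _ ≤ 4 / (cQ * cL) * 49 * πN :=
          mul_le_mul_of_nonneg_right (mul_le_mul_of_nonneg_left hX (by positivity)) hπN0
      _ = Bc * πN := by rw [hBc]; ring

/-! ### The upper bound for the rhombus, in Werner's conventions -/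

/-- **The upper bound of the pivotal count of the rhombus below `L(p)`, Werner's conventions**
(Werner 2009, Lecture 6, proof of Lemma 6.2: "the contributions due to those `x`'s that are close to
the edges … do not matter much"; Nolin 2008, Remark 35 [arXiv: Remark 34]: "when we get closer to
`∂S_N`, one of the arms is shorter, but the remaining arms have less space"), PROVED from
`Werner2009_fourArm_quasiMult`, `Werner2009_fourArm_lowerBound` and `Werner2009_halfPlane_twoArm`:
for every small enough `ε` and every large `r₀` there are `n₁`, `δ > 0`, `C` with
`Σ_{v ∈ [0,N]²} P_t(v pivotal for 𝒞_H([0,N]²)) ≤ C N² π̂_t(r₀, N)` for `1/2 ≤ t < 1/2 + δ`, `n₁ ≤ N`,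
`N ≤ L(t, ε)` if `t > 1/2` (`L = charLengthW`, `π̂_t = fourArmProbAt t`). Envelope
`wide_site_envelope_le` with `m = N`, summed by `sum_rectangle_le_envelope`. [cite: WernerPCMI2009, Lecture 6, proof of Lemma 6.2 (upper bound)] [cite: Nolin2008, §7.3, Remark 35 (arXiv 0711.4948: Remark 34)] -/
theorem rhombusPivotalSum_upper_W (hQM : Werner2009_fourArm_quasiMult)
    (hLB : Werner2009_fourArm_lowerBound) (hHP : Werner2009_halfPlane_twoArm) :
    ∃ ε₁ > (0 : ℝ), ∀ ⦃ε : ℝ⦄, 0 < ε → ε < ε₁ →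
      ∃ r₁ : ℕ, ∀ r₀ ≥ r₁, ∃ n₁ : ℕ, ∃ δ > (0 : ℝ), ∃ C : ℝ,
        ∀ t : unitInterval, 1 / 2 ≤ (t : ℝ) → (t : ℝ) < 1 / 2 + δ →
          ∀ N : ℕ, n₁ ≤ N → (1 / 2 < (t : ℝ) → N ≤ charLengthW ε t) →
            rhombusPivotalSum t N ≤ C * ((N : ℝ) ^ 2 * fourArmProbAt t r₀ N) := by
  classical
  obtain ⟨εQ, hεQ, HQ⟩ := hQM
  obtain ⟨εL, hεL, HL⟩ := hLB
  obtain ⟨εH, hεH, HH⟩ := hHP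
  refine ⟨min εQ (min εL εH), lt_min hεQ (lt_min hεL hεH), fun ε hε hε₁ => ?_⟩
  obtain ⟨rQ, δQ, hδQ, cQ, hcQ, hQ⟩ := HQ hε (hε₁.trans_le (min_le_left _ _))
  obtain ⟨rL, δL, hδL, β₀, hβ₀, cL, hcL, hL⟩ :=
    HL hε (hε₁.trans_le ((min_le_right _ _).trans (min_le_left _ _)))
  obtain ⟨n₀, δH, hδH, CH, hH⟩ :=
    HH hε (hε₁.trans_le ((min_le_right _ _).trans (min_le_right _ _)))
  set β : ℝ := min β₀ 1 with hβdef
  have hβ : 0 < β := lt_min hβ₀ one_pos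
  have hβ1 : β ≤ 1 := min_le_right _ _
  have hβ2 : β ≤ 2 := hβ1.trans one_le_two
  have hββ₀ : β ≤ β₀ := min_le_left _ _
  refine ⟨max (max rQ rL) 1, fun r₀ hr₀ => ?_⟩
  have hrQ : rQ ≤ r₀ := ((le_max_left _ _).trans (le_max_left _ _)).trans hr₀
  have hrL : rL ≤ r₀ := ((le_max_right _ _).trans (le_max_left _ _)).trans hr₀
  have hr1 : 1 ≤ r₀ := (le_max_right _ _).trans hr₀
  obtain ⟨i₀, hi₀⟩ : ∃ i₀ : ℕ, i₀ = 4 * r₀ + 1 + rL + n₀ + 1 := ⟨_, rfl⟩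
  -- `CH ≥ 0` from the fact at `t = 1/2`, `m = n = max n₀ 1`
  have hCH0 : 0 ≤ CH := by
    have h := hH half (by rw [coe_half]) (by rw [coe_half]; linarith) (max n₀ 1) (max n₀ 1)
      (le_max_left _ _) le_rfl (fun h => by rw [coe_half] at h; exact absurd h (lt_irrefl _))
    have hne : ((max n₀ 1 : ℕ) : ℝ) ≠ 0 := Nat.cast_ne_zero.2 (by omega)
    rw [div_self hne, mul_one] at h
    exact measureReal_nonneg.trans h
  set K : ℝ := 36 * CH / (cQ * cL) with hK
  set Bc : ℝ := 196 / (cQ * cL) with hBc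
  have hK0 : 0 ≤ K := by rw [hK]; positivity
  have hBc0 : 0 ≤ Bc := by rw [hBc]; positivity
  refine ⟨max 8000 (40 * i₀), min δQ (min δL δH), lt_min hδQ (lt_min hδL hδH),
    10 * K * (1 + 1 / β) + 5 * Bc + 15 * CH * i₀ * (n₀ + 1 + i₀) / cL, fun t ht htδ N hN hNL => ?_⟩
  have hN8 : 8000 ≤ N := (le_max_left _ _).trans hN
  have hNi : 40 * i₀ ≤ N := (le_max_right _ _).trans hN
  have hN0 : (0 : ℝ) < N := by exact_mod_cast (show 0 < N by omega)
  have htQ : (t : ℝ) < 1 / 2 + δQ := htδ.trans_le (by gcongr; exact min_le_left _ _)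
  have htL : (t : ℝ) < 1 / 2 + δL := htδ.trans_le (by gcongr; exact (min_le_right _ _).trans (min_le_left _ _))
  have htH : (t : ℝ) < 1 / 2 + δH := htδ.trans_le (by gcongr; exact (min_le_right _ _).trans (min_le_right _ _))
  -- the facts at `t`, radii `≤ N`
  have hQt : ∀ R S : ℕ, 16 * r₀ < 4 * R → 4 * R < S → S ≤ N →
      cQ * (fourArmProbAt t r₀ R * fourArmProbAt t (4 * R) S) ≤ fourArmProbAt t r₀ S :=
    fun R S h1 h2 h3 => hQ t ht htQ r₀ R S hrQ h1 h2 fun ht' => h3.trans (hNL ht')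
  have hLt : ∀ m n : ℕ, rL ≤ m → m ≤ n → n ≤ N →
      cL * ((m : ℝ) / n) ^ (2 - β) ≤ fourArmProbAt t m n := by
    intro m n h1 h2 h3
    have h := hL t ht htL m n h1 h2 fun ht' => h3.trans (hNL ht')
    refine le_trans (mul_le_mul_of_nonneg_left ?_ hcL.le) h
    rcases Nat.eq_zero_or_pos m with hm | hm
    · subst hm
      simp only [CharP.cast_eq_zero, zero_div]
      rw [Real.zero_rpow (ne_of_gt (by linarith))]
      exact Real.rpow_nonneg le_rfl _
    · have hn : 0 < n := by omega
      apply Real.rpow_le_rpow_of_exponent_ge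
      · exact div_pos (by exact_mod_cast hm) (by exact_mod_cast hn)
      · rw [div_le_one (by exact_mod_cast hn)]; exact_mod_cast h2
      · linarith
  have hHt : ∀ m n : ℕ, n₀ ≤ m → m ≤ n → n ≤ N →
      (triSitePercolation t).real (domArmEvent ![true, false] m n upperHalfPlane) ≤ CH * ((m : ℝ) / n) :=
    fun m n h1 h2 h3 => hH t ht htH m n h1 h2 fun ht' => h3.trans (hNL ht')
  obtain ⟨πN, hπNdef⟩ : ∃ x : ℝ, x = fourArmProbAt t r₀ N := ⟨_, rfl⟩
  rw [← hπNdef]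
  have hπN0 : 0 ≤ πN := by rw [hπNdef]; exact fourArmProbAt_nonneg t r₀ N
  -- `N² π̂(r₀, N) ≥ c_L`
  have hNπ : cL ≤ (N : ℝ) ^ 2 * πN := by
    have h := hLt r₀ N hrL (by omega) le_rfl
    rw [← hπNdef] at h
    have hr0 : (0 : ℝ) < r₀ := by exact_mod_cast (show 0 < r₀ by omega)
    have hbase : (r₀ : ℝ) / N ≤ 1 := by rw [div_le_one hN0]; exact_mod_cast (show r₀ ≤ N by omega)
    have hb0 : (0 : ℝ) < (r₀ : ℝ) / N := div_pos hr0 hN0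
    have h1 : ((r₀ : ℝ) / N) ^ (2 : ℝ) ≤ ((r₀ : ℝ) / N) ^ (2 - β) :=
      Real.rpow_le_rpow_of_exponent_ge hb0 hbase (by linarith)
    have h2 : (1 / (N : ℝ)) ^ 2 ≤ ((r₀ : ℝ) / N) ^ (2 : ℝ) := by
      rw [Real.rpow_two]
      apply pow_le_pow_left₀ (by positivity)
      exact div_le_div_of_nonneg_right (by exact_mod_cast hr1) hN0.le
    have h3 : (N : ℝ) ^ 2 * (1 / (N : ℝ)) ^ 2 = 1 := by field_simp
    have h4 : cL = (N : ℝ) ^ 2 * (cL * (1 / (N : ℝ)) ^ 2) := by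
      calc cL = cL * ((N : ℝ) ^ 2 * (1 / (N : ℝ)) ^ 2) := by rw [h3, mul_one]
        _ = (N : ℝ) ^ 2 * (cL * (1 / (N : ℝ)) ^ 2) := by ring
    calc cL = (N : ℝ) ^ 2 * (cL * (1 / (N : ℝ)) ^ 2) := h4
      _ ≤ (N : ℝ) ^ 2 * (cL * ((r₀ : ℝ) / N) ^ (2 - β)) := by
          apply mul_le_mul_of_nonneg_left _ (by positivity)
          exact mul_le_mul_of_nonneg_left (h2.trans h1) hcL.le
      _ ≤ (N : ℝ) ^ 2 * πN := mul_le_mul_of_nonneg_left h (by positivity)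
  -- the envelope
  set S : ℝ := 3 * CH * (n₀ + 1 + i₀) / N with hSdef
  have hS0 : 0 ≤ S := by rw [hSdef]; positivity
  set ψ : ℕ → ℝ := fun d => (if d < i₀ then S else 0) +
    K * (((N : ℝ) / d) ^ (2 - β) * ((d : ℝ) / N)) * πN + Bc * πN with hψ
  have hψ0 : ∀ d, 0 ≤ ψ d := fun d => by
    rw [hψ]; dsimp only
    have : 0 ≤ (if d < i₀ then S else 0) := by split_ifs <;> linarith
    positivity
  -- the per-site bound through the depth
  have hsite : ∀ (v : Site 2) (d : ℕ),
      ((d : ℤ) = v 0 ∨ (d : ℤ) = (N : ℕ) - v 0 ∨ (d : ℤ) = v 1 ∨ (d : ℤ) = (N : ℕ) - v 1) →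
      (d : ℤ) ≤ v 0 → v 0 + d ≤ (N : ℕ) → (d : ℤ) ≤ v 1 → v 1 + d ≤ (N : ℕ) →
      (triSitePercolation t).real {ω | IsPivotal (triLRCrossing N N) v ω} ≤ ψ d :=
    fun v d hd h0 h0' h1 h1' => wide_site_envelope_le le_rfl hcQ hcL hβ hβ2 hCH0 hr1 hi₀ hN8 hNi
      hQt hLt hHt hπNdef hK hBc hSdef v d hd h0 h0' h1 h1'
  -- the envelope hypothesis of `sum_rectangle_le_envelope`
  have henv : ∀ a ≤ N, ∀ b ≤ N,
      (triSitePercolation t).real {ω | IsPivotal (triLRCrossing N N) ![(a : ℤ), (b : ℤ)] ω} ≤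
        ψ a + ψ (N - a) + ψ b + ψ (N - b) := by
    intro a ha b hb
    -- the depth
    set d : ℕ := min (min a (N - a)) (min b (N - b)) with hd
    have hv0 : (![(a : ℤ), (b : ℤ)] : Site 2) 0 = a := rfl
    have hv1 : (![(a : ℤ), (b : ℤ)] : Site 2) 1 = b := rfl
    have hle : (triSitePercolation t).real
        {ω | IsPivotal (triLRCrossing N N) ![(a : ℤ), (b : ℤ)] ω} ≤ ψ d := by
      apply hsite _ d
      · rw [hv0, hv1]
        rcases Nat.le_total (min a (N - a)) (min b (N - b)) with h | h
        · rcases Nat.le_total a (N - a) with h' | h'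
          · left; rw [hd]; push_cast; omega
          · right; left; rw [hd]; push_cast; omega
        · rcases Nat.le_total b (N - b) with h' | h'
          · right; right; left; rw [hd]; push_cast; omega
          · right; right; right; rw [hd]; push_cast; omega
      all_goals rw [hd]; simp only [hv0, hv1]; push_cast; omega
    have hcases : d = a ∨ d = N - a ∨ d = b ∨ d = N - b := by rw [hd]; omega
    have g1 := hψ0 a; have g2 := hψ0 (N - a); have g3 := hψ0 b; have g4 := hψ0 (N - b)
    rcases hcases with h | h | h | h <;> rw [h] at hle <;> linarith only [hle, g1, g2, g3, g4]
  -- summation over the depth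
  have hsumψ : ∑ d ∈ Finset.range (N + 1), ψ d ≤
      i₀ * S + K * πN * (2 * (1 + 1 / β) * N) + (N + 1) * (Bc * πN) := by
    rw [hψ]
    rw [Finset.sum_add_distrib, Finset.sum_add_distrib, Finset.sum_const, Finset.card_range,
      nsmul_eq_mul]
    push_cast
    have h1 := sum_shallow_envelope_le hS0 i₀ N
    have h2 : ∑ d ∈ Finset.range (N + 1), K * (((N : ℝ) / d) ^ (2 - β) * ((d : ℝ) / N)) * πN ≤
        K * πN * (2 * (1 + 1 / β) * N) := by
      have : ∑ d ∈ Finset.range (N + 1), K * (((N : ℝ) / d) ^ (2 - β) * ((d : ℝ) / N)) * πN =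
          K * πN * ∑ d ∈ Finset.range (N + 1), ((N : ℝ) / d) ^ (2 - β) * ((d : ℝ) / N) := by
        rw [Finset.mul_sum]; refine Finset.sum_congr rfl fun d _ => ?_; ring
      rw [this]
      exact mul_le_mul_of_nonneg_left (sum_layer_envelope_le hβ hβ1 (by omega) (by omega) (by omega))
        (by positivity)
    linarith
  have htotal := sum_rectangle_le_envelope N N
    (fun v => (triSitePercolation t).real {ω | IsPivotal (triLRCrossing N N) v ω}) ψ henv
  rw [rhombusPivotalSum]
  refine htotal.trans ?_
  have hΨ0 : 0 ≤ i₀ * S + K * πN * (2 * (1 + 1 / β) * N) := by positivity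
  -- `i₀ S ≤ cst/N`-type term against `N² π̂ ≥ c_L`
  have h1 : (1 : ℝ) ≤ (N : ℝ) ^ 2 * πN / cL := by rw [le_div_iff₀ hcL, one_mul]; exact hNπ
  have hiS : (5 * N) * (i₀ * S) ≤ 15 * CH * i₀ * (n₀ + 1 + i₀) / cL * ((N : ℝ) ^ 2 * πN) := by
    have e1 : (5 * N) * (i₀ * S) = 15 * CH * i₀ * (n₀ + 1 + i₀) := by rw [hSdef]; field_simp; ring
    rw [e1]
    have hc0 : 0 ≤ 15 * CH * (i₀ : ℝ) * (n₀ + 1 + i₀) := by positivity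
    calc 15 * CH * (i₀ : ℝ) * (n₀ + 1 + i₀) = 15 * CH * i₀ * (n₀ + 1 + i₀) * 1 := by ring
      _ ≤ 15 * CH * i₀ * (n₀ + 1 + i₀) * ((N : ℝ) ^ 2 * πN / cL) := mul_le_mul_of_nonneg_left h1 hc0
      _ = 15 * CH * i₀ * (n₀ + 1 + i₀) / cL * ((N : ℝ) ^ 2 * πN) := by field_simp
  have hN9 : (9 : ℝ) ≤ N := by exact_mod_cast (show 9 ≤ N by omega)
  set X : ℝ := i₀ * S + K * πN * (2 * (1 + 1 / β) * N) with hX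
  set Y : ℝ := Bc * πN with hY
  have hY0 : 0 ≤ Y := by rw [hY]; positivity
  have hstep1 : 2 * ((N : ℝ) + 1) * ∑ a ∈ Finset.range (N + 1), ψ a +
      2 * ((N : ℕ) + 1 : ℝ) * ∑ b ∈ Finset.range (N + 1), ψ b ≤
      2 * ((N : ℝ) + 1) * (X + ((N : ℝ) + 1) * Y) + 2 * ((N : ℝ) + 1) * (X + ((N : ℝ) + 1) * Y) :=
    add_le_add (mul_le_mul_of_nonneg_left hsumψ (by positivity))
      (mul_le_mul_of_nonneg_left hsumψ (by positivity))
  have hstep2 : 2 * ((N : ℝ) + 1) * (X + ((N : ℝ) + 1) * Y) + 2 * ((N : ℝ) + 1) * (X + ((N : ℝ) + 1) * Y) ≤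
      5 * N * X + 5 * (N : ℝ) ^ 2 * Y := by
    have hNX : 0 ≤ ((N : ℝ) - 4) * X := mul_nonneg (by linarith only [hN9]) hΨ0
    have hNY : 0 ≤ ((N : ℝ) ^ 2 - 8 * N - 4) * Y := mul_nonneg (by nlinarith only [hN9]) hY0
    linear_combination hNX + hNY
  have hstep3 : 5 * (N : ℝ) * X + 5 * (N : ℝ) ^ 2 * Y ≤
      (10 * K * (1 + 1 / β) + 5 * Bc + 15 * CH * i₀ * (n₀ + 1 + i₀) / cL) * ((N : ℝ) ^ 2 * πN) := by
    have e2 : 5 * (N : ℝ) * X = (5 * N) * (i₀ * S) + 10 * K * (1 + 1 / β) * ((N : ℝ) ^ 2 * πN) := by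
      rw [hX]; ring
    have e3 : 5 * (N : ℝ) ^ 2 * Y = 5 * Bc * ((N : ℝ) ^ 2 * πN) := by rw [hY]; ring
    rw [e2, e3]
    linarith only [hiS]
  exact hstep1.trans (hstep2.trans hstep3)

/-! ### The lower bound from a pointwise interior bound -/

/-- **Counting the interior sites** (Werner 2009, Lecture 6, proof of Lemma 6.2: "the contribution
of the `O(n²)` points `x` that are at distance more than `n/4` of the boundary … is at least
`π̂_p(n)`"): if every site `v` of `[0, N]²` with `N/4 < v₀, v₁ < 3N/4` is pivotal for `𝒞_H([0,N]²)`
with probability `≥ c q`, then `Σ_{v ∈ [0,N]²} P_t(v pivotal) ≥ (c/64) N² q` (the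
`⌊N/4⌋² ≥ N²/64` sites `(a, b)` with `N/4 < a, b ≤ N/4 + ⌊N/4⌋`; `N ≥ 16`). Pure counting; the
pointwise hypothesis is the rhombus form of `Werner2009_pivotal_lowerBound`, see
`Werner2009_lemma62_of_facts`. [cite: WernerPCMI2009, Lecture 6, proof of Lemma 6.2 (lower bound)] -/
theorem rhombusPivotalSum_lower_of_forall {t : unitInterval} {N : ℕ} {c q : ℝ} (hc : 0 ≤ c)
    (hq : 0 ≤ q) (hN : 16 ≤ N)
    (h : ∀ v : Site 2, (N : ℤ) < 4 * v 0 → 4 * v 0 < 3 * N → (N : ℤ) < 4 * v 1 → 4 * v 1 < 3 * N →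
      c * q ≤ (triSitePercolation t).real {ω | IsPivotal (triLRCrossing N N) v ω}) :
    c / 64 * ((N : ℝ) ^ 2 * q) ≤ rhombusPivotalSum t N := by
  classical
  set e : ℕ × ℕ → Site 2 := fun p => ![(p.1 : ℤ), (p.2 : ℤ)] with he
  set S : Finset (ℕ × ℕ) :=
    Finset.Ico (N / 4 + 1) (N / 4 + 1 + N / 4) ×ˢ Finset.Ico (N / 4 + 1) (N / 4 + 1 + N / 4) with hS
  have hSsub : S.image e ⊆ rectangle N N := by
    intro v hv
    rw [Finset.mem_image] at hv
    obtain ⟨⟨a, b⟩, hab, rfl⟩ := hv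
    rw [hS, Finset.mem_product, Finset.mem_Ico, Finset.mem_Ico] at hab
    rw [mem_rectangle_iff]
    simp only [he, Matrix.cons_val_zero, Matrix.cons_val_one]
    omega
  have hcard : (S.card : ℝ) = (N / 4 : ℕ) * (N / 4 : ℕ) := by
    rw [hS, Finset.card_product, Nat.card_Ico]
    push_cast
    have h1 : N / 4 + 1 + N / 4 - (N / 4 + 1) = N / 4 := by omega
    rw [h1]
  have hsite : ∀ p ∈ S, c * q ≤
      (triSitePercolation t).real {ω | IsPivotal (triLRCrossing N N) (e p) ω} := by
    rintro ⟨a, b⟩ hab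
    rw [hS, Finset.mem_product, Finset.mem_Ico, Finset.mem_Ico] at hab
    apply h
    all_goals simp only [he, Matrix.cons_val_zero, Matrix.cons_val_one]; omega
  have hN4 : (N : ℝ) / 8 ≤ ((N / 4 : ℕ) : ℝ) := by
    have h' : (N : ℝ) ≤ 8 * ((N / 4 : ℕ) : ℝ) := by exact_mod_cast (show N ≤ 8 * (N / 4) by omega)
    rw [div_le_iff₀ (by norm_num : (0 : ℝ) < 8)]
    linarith
  calc c / 64 * ((N : ℝ) ^ 2 * q)
      = (((N : ℝ) / 8) * ((N : ℝ) / 8)) * (c * q) := by ring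
    _ ≤ (((N / 4 : ℕ) : ℝ) * ((N / 4 : ℕ) : ℝ)) * (c * q) := by
        apply mul_le_mul_of_nonneg_right _ (by positivity)
        exact mul_le_mul hN4 hN4 (by positivity) (Nat.cast_nonneg _)
    _ = ∑ p ∈ S, c * q := by rw [Finset.sum_const, nsmul_eq_mul, hcard]
    _ ≤ ∑ p ∈ S, (triSitePercolation t).real {ω | IsPivotal (triLRCrossing N N) (e p) ω} :=
        Finset.sum_le_sum hsite
    _ = ∑ v ∈ S.image e, (triSitePercolation t).real {ω | IsPivotal (triLRCrossing N N) v ω} :=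
        (Finset.sum_image (s := S) (g := e)
          (f := fun v => (triSitePercolation t).real {ω | IsPivotal (triLRCrossing N N) v ω})
          (fun p _ q _ h => mkSite_injective h)).symm
    _ ≤ rhombusPivotalSum t N := by
        rw [rhombusPivotalSum]
        exact Finset.sum_le_sum_of_subset_of_nonneg hSsub fun _ _ _ => measureReal_nonneg

/-! ### From Werner's conventions to Nolin's: `L_ε ≤ L(·, ε')`, both sides of `1/2`, critical `π₄` -/

/-- **Bridge between the two characteristic lengths**: for `0 < ε' ≤ ε` and `t ≠ 1/2`,
`L_ε(t) ≤ L(t, ε')` (`charLength_anti`: `L_ε ≤ L_{ε'}`, Nolin 2008, proof of Cor. 35; and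
`charLength_le_charLengthW`: `L_{ε'}(t) ≤ L(t, ε')`, the `2L × L` parallelogram being harder to
cross than the `L × L` rhombus, Werner 2009, Lecture 6, §1), so that estimates below Werner's
length at a small `ε'` hold below Nolin's length at every `ε ≥ ε'`. [cite: Nolin2008, §7.3, proof of Cor. 35 (arXiv 0711.4948: Cor. 33)] [cite: WernerPCMI2009, Lecture 6, §1 (remark on the rhombus definition of L)] -/
theorem charLength_le_charLengthW_of_le {ε ε' : ℝ} (hε' : 0 < ε') (hle : ε' ≤ ε) {t : unitInterval}
    (ht : (t : ℝ) ≠ 1 / 2) : charLength ε t ≤ charLengthW ε' t :=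
  (charLength_anti Nolin2008_subcritical_crossing_holds hε' hle ht).trans
    (charLength_le_charLengthW hε' ht)

/-- **The upper half of `Werner2009_lemma62` holds, given four named facts** (Werner 2009,
Lecture 6, Lemma 6.2 (upper bound) with Lemma 6.3; Nolin 2008, Remark 35 [arXiv: Remark 34]): from
`Werner2009_lemma63`, `Werner2009_fourArm_quasiMult`, `Werner2009_fourArm_lowerBound` and
`Werner2009_halfPlane_twoArm`, for every `ε ∈ (0, 1/2)` and every large inner radius `r₀` there
are `n₁`, `δ > 0` and `C` with `Σ_{v ∈ [0,N]²} P_t(v pivotal for 𝒞_H([0,N]²)) ≤ C N² π₄(N)`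
(`π₄(N) = critFourArmProb r₀ N`) for `|t - 1/2| < δ` and `n₁ ≤ N ≤ L_ε(t)` (`L_ε = charLength ε`; no
upper restriction at `t = 1/2`): `rhombusPivotalSum_upper_W` at `ε' = min ε (ε₁/2)`, the bridge
`charLength_le_charLengthW_of_le`, the stability `π̂_t(r₀, N) ≤ C' π₄(N)` (`Werner2009_lemma63`), and
the symmetry `rhombusPivotalSum_symm` for `t < 1/2`. [cite: WernerPCMI2009, Lecture 6, Lemma 6.2 (upper bound) with Lemma 6.3] [cite: Nolin2008, §7.3, Remark 35 (arXiv 0711.4948: Remark 34)] -/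
theorem rhombusPivotalSum_upper_of_facts (h63 : Werner2009_lemma63)
    (hQM : Werner2009_fourArm_quasiMult) (hLB : Werner2009_fourArm_lowerBound)
    (hHP : Werner2009_halfPlane_twoArm) :
    ∀ ⦃ε : ℝ⦄, 0 < ε → ε < 1 / 2 →
      ∃ r₁ : ℕ, ∀ r₀ ≥ r₁, ∃ n₁ : ℕ, ∃ δ > (0 : ℝ), ∃ C : ℝ,
        ∀ t : unitInterval, |(t : ℝ) - 1 / 2| < δ →
          ∀ N : ℕ, n₁ ≤ N → ((t : ℝ) ≠ 1 / 2 → N ≤ charLength ε t) →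
            rhombusPivotalSum t N ≤ C * ((N : ℝ) ^ 2 * critFourArmProb r₀ N) := by
  obtain ⟨εU, hεU, HU⟩ := rhombusPivotalSum_upper_W hQM hLB hHP
  obtain ⟨εS, hεS, HS⟩ := h63
  intro ε hε _
  -- a small auxiliary `ε'`
  set ε' : ℝ := min ε (min εU εS / 2) with hε'
  have hε'0 : 0 < ε' := lt_min hε (by positivity)
  have hε'ε : ε' ≤ ε := min_le_left _ _
  have hε'U : ε' < εU := (min_le_right _ _).trans_lt (by linarith [min_le_left εU εS])
  have hε'S : ε' < εS := (min_le_right _ _).trans_lt (by linarith [min_le_right εU εS])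
  obtain ⟨rU, HU⟩ := HU hε'0 hε'U
  obtain ⟨rS, HS⟩ := HS hε'0 hε'S
  refine ⟨max rU rS, fun r₀ hr₀ => ?_⟩
  obtain ⟨nU, δU, hδU, CU, HU⟩ := HU r₀ ((le_max_left _ _).trans hr₀)
  obtain ⟨nS, δS, hδS, cS, hcS, CS, HS⟩ := HS r₀ ((le_max_right _ _).trans hr₀)
  refine ⟨max nU nS, min δU δS, lt_min hδU hδS, max CU 0 * CS, fun t ht N hN hNL => ?_⟩
  -- one-sided statement, then symmetry
  have key : ∀ s : unitInterval, 1 / 2 ≤ (s : ℝ) → (s : ℝ) < 1 / 2 + min δU δS →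
      (1 / 2 < (s : ℝ) → N ≤ charLength ε s) →
      rhombusPivotalSum s N ≤ max CU 0 * CS * ((N : ℝ) ^ 2 * critFourArmProb r₀ N) := by
    intro s hs1 hs2 hsL
    have hsW : 1 / 2 < (s : ℝ) → N ≤ charLengthW ε' s := fun h =>
      (hsL h).trans (charLength_le_charLengthW_of_le hε'0 hε'ε h.ne')
    have hu := HU s hs1 (hs2.trans_le (by gcongr; exact min_le_left _ _)) N
      ((le_max_left _ _).trans hN) hsW
    have hst := (HS s hs1 (hs2.trans_le (by gcongr; exact min_le_right _ _)) N
      ((le_max_right _ _).trans hN) hsW).2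
    have hX0 : 0 ≤ (N : ℝ) ^ 2 * fourArmProbAt s r₀ N :=
      mul_nonneg (sq_nonneg _) (fourArmProbAt_nonneg s r₀ N)
    calc rhombusPivotalSum s N ≤ CU * ((N : ℝ) ^ 2 * fourArmProbAt s r₀ N) := hu
      _ ≤ max CU 0 * ((N : ℝ) ^ 2 * fourArmProbAt s r₀ N) :=
          mul_le_mul_of_nonneg_right (le_max_left _ _) hX0
      _ ≤ max CU 0 * ((N : ℝ) ^ 2 * (CS * critFourArmProb r₀ N)) :=
          mul_le_mul_of_nonneg_left (mul_le_mul_of_nonneg_left hst (sq_nonneg _)) (le_max_right _ _)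
      _ = max CU 0 * CS * ((N : ℝ) ^ 2 * critFourArmProb r₀ N) := by ring
  obtain ⟨ht1, ht2⟩ := abs_sub_lt_iff.1 ht
  rcases le_or_gt (1 / 2 : ℝ) t with hle | hlt
  · exact key t hle (by linarith) fun h' => hNL h'.ne'
  · have hs : ((σ t : unitInterval) : ℝ) = 1 - t := unitInterval.coe_symm_eq t
    have hk := key (σ t) (by rw [hs]; linarith) (by rw [hs]; linarith) fun _ => by
      rw [charLength_symm]; exact hNL hlt.ne
    rwa [rhombusPivotalSum_symm] at hk

/-- **`Werner2009_lemma62` from Werner's near-critical facts and the interior pivotal lower bound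
for the rhombus** (Werner 2009, Lecture 6, Lemma 6.2 with Lemma 6.3; Nolin 2008, proof of Prop. 34
and Remark 35 [arXiv 0711.4948: Prop. 32, Remark 34]). Hypotheses: the tree's named facts
`Werner2009_lemma63` (four-arm stability, Lemma 6.3), `Werner2009_fourArm_quasiMult` (Cor. 6.2),
`Werner2009_fourArm_lowerBound` (§3), `Werner2009_halfPlane_twoArm` (§3 ¶1), and — as an explicit
hypothesis `hP`, NOT a fact of the tree — the RHOMBUS form of `Werner2009_pivotal_lowerBound`
(`NearCriticalBoundaryFacts.lean`, stated there for Werner's `2N × N` parallelogram): every site of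
`[0, N]²` at distance more than `N/4` from its boundary is pivotal for `𝒞_H([0,N]²)` with
probability `≥ c π̂_t(r₀, N)`, uniformly for `1/2 ≤ t < 1/2 + δ`, `n₁ ≤ N ≤ L(t, ε)` — Nolin 2008,
proof of Prop. 34, last display (`P̂(v ⇝^{4,σ₄,Ī} ∂[0,L]²) ≍ P̂(v ⇝^{4,σ₄} ∂S_{ηL}(v))`, by the
separation and extendability of four arms below `L(p)`, Thm. 11 and Props. 12–13 there; Werner,
proof of Lemma 6.2: "the contribution of the `O(n²)` points `x` that are at distance more than
`n/4` of the boundary … is at least `π̂_p(n)`"). It is kept as a hypothesis rather than recorded as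
a named fact (D-0026); discharging it, or proving the four-arm separation it rests on, closes
`Werner2009_lemma62` through this theorem. Proof: `Werner2009_lemma62_of_half_le` (symmetry about
`1/2`), the bridge `charLength_le_charLengthW_of_le` at `ε' = min ε (ε₁/2)`, the upper bound
`rhombusPivotalSum_upper_W`, the counting `rhombusPivotalSum_lower_of_forall`, and both halves of
`Werner2009_lemma63` to pass from `π̂_t(r₀, N)` to `π₄(N) = critFourArmProb r₀ N`. [cite: WernerPCMI2009, Lecture 6, Lemma 6.2 with Lemma 6.3] [cite: Nolin2008, §7.3, proof of Prop. 34 (last display) and Remark 35 (arXiv 0711.4948: Prop. 32, Remark 34)] -/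
theorem Werner2009_lemma62_of_facts (h63 : Werner2009_lemma63)
    (hQM : Werner2009_fourArm_quasiMult) (hLB : Werner2009_fourArm_lowerBound)
    (hHP : Werner2009_halfPlane_twoArm)
    (hP : ∃ ε₁ > (0 : ℝ), ∀ ⦃ε : ℝ⦄, 0 < ε → ε < ε₁ →
      ∃ r₁ : ℕ, ∀ r₀ ≥ r₁, ∃ n₁ : ℕ, ∃ δ > (0 : ℝ), ∃ c > (0 : ℝ),
        ∀ t : unitInterval, 1 / 2 ≤ (t : ℝ) → (t : ℝ) < 1 / 2 + δ →
          ∀ N : ℕ, n₁ ≤ N → (1 / 2 < (t : ℝ) → N ≤ charLengthW ε t) →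
            ∀ v : Site 2, (N : ℤ) < 4 * v 0 → 4 * v 0 < 3 * N → (N : ℤ) < 4 * v 1 → 4 * v 1 < 3 * N →
              c * fourArmProbAt t r₀ N ≤
                (triSitePercolation t).real {ω | IsPivotal (triLRCrossing N N) v ω}) :
    Werner2009_lemma62 := by
  obtain ⟨εU, hεU, HU⟩ := rhombusPivotalSum_upper_W hQM hLB hHP
  obtain ⟨εS, hεS, HS⟩ := h63
  obtain ⟨εP, hεP, HP⟩ := hP
  refine Werner2009_lemma62_of_half_le fun ε hε _ => ?_
  -- a small auxiliary `ε'`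
  set ε' : ℝ := min ε (min εU (min εS εP) / 2) with hε'
  have hm0 : 0 < min εU (min εS εP) := lt_min hεU (lt_min hεS hεP)
  have hε'0 : 0 < ε' := lt_min hε (by positivity)
  have hε'ε : ε' ≤ ε := min_le_left _ _
  have hε'U : ε' < εU := (min_le_right _ _).trans_lt (by linarith [min_le_left εU (min εS εP)])
  have hε'S : ε' < εS :=
    (min_le_right _ _).trans_lt (by linarith [min_le_right εU (min εS εP), min_le_left εS εP])
  have hε'P : ε' < εP :=
    (min_le_right _ _).trans_lt (by linarith [min_le_right εU (min εS εP), min_le_right εS εP])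
  obtain ⟨rU, HU⟩ := HU hε'0 hε'U
  obtain ⟨rS, HS⟩ := HS hε'0 hε'S
  obtain ⟨rP, HP⟩ := HP hε'0 hε'P
  refine ⟨max rU (max rS rP), fun r₀ hr₀ => ?_⟩
  obtain ⟨nU, δU, hδU, CU, HU⟩ := HU r₀ ((le_max_left _ _).trans hr₀)
  obtain ⟨nS, δS, hδS, cS, hcS, CS, HS⟩ := HS r₀ (((le_max_left _ _).trans (le_max_right _ _)).trans hr₀)
  obtain ⟨nP, δP, hδP, cP, hcP, HP⟩ := HP r₀ (((le_max_right _ _).trans (le_max_right _ _)).trans hr₀)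
  refine ⟨max (max nU nS) (max nP 16), min δU (min δS δP), lt_min hδU (lt_min hδS hδP),
    cP / 64 * cS, by positivity, max CU 0 * CS, fun t ht1 ht2 N hN hNL => ?_⟩
  have hNU : nU ≤ N := ((le_max_left _ _).trans (le_max_left _ _)).trans hN
  have hNS : nS ≤ N := ((le_max_right _ _).trans (le_max_left _ _)).trans hN
  have hNP : nP ≤ N := ((le_max_left _ _).trans (le_max_right _ _)).trans hN
  have hN16 : 16 ≤ N := ((le_max_right _ _).trans (le_max_right _ _)).trans hN
  have htU : (t : ℝ) < 1 / 2 + δU := ht2.trans_le (by gcongr; exact min_le_left _ _)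
  have htS : (t : ℝ) < 1 / 2 + δS := ht2.trans_le (by gcongr; exact (min_le_right _ _).trans (min_le_left _ _))
  have htP : (t : ℝ) < 1 / 2 + δP := ht2.trans_le (by gcongr; exact (min_le_right _ _).trans (min_le_right _ _))
  -- Nolin's length at `ε` is below Werner's at `ε'`
  have hW : 1 / 2 < (t : ℝ) → N ≤ charLengthW ε' t := fun h =>
    (hNL h).trans (charLength_le_charLengthW_of_le hε'0 hε'ε h.ne')
  obtain ⟨hst1, hst2⟩ := HS t ht1 htS N hNS hW
  have hπ0 : 0 ≤ fourArmProbAt t r₀ N := fourArmProbAt_nonneg t r₀ N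
  have hπ40 : 0 ≤ critFourArmProb r₀ N := measureReal_nonneg
  constructor
  · -- lower bound: counting the interior sites, then `c_S π₄ ≤ π̂_t`
    have hlow := rhombusPivotalSum_lower_of_forall hcP.le hπ0 hN16 (HP t ht1 htP N hNP hW)
    calc cP / 64 * cS * ((N : ℝ) ^ 2 * critFourArmProb r₀ N)
        = cP / 64 * ((N : ℝ) ^ 2 * (cS * critFourArmProb r₀ N)) := by ring
      _ ≤ cP / 64 * ((N : ℝ) ^ 2 * fourArmProbAt t r₀ N) := by
          apply mul_le_mul_of_nonneg_left _ (by positivity)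
          exact mul_le_mul_of_nonneg_left hst1 (sq_nonneg _)
      _ ≤ rhombusPivotalSum t N := hlow
  · -- upper bound: the envelope, then `π̂_t ≤ C_S π₄`
    have hu := HU t ht1 htU N hNU hW
    have hX0 : 0 ≤ (N : ℝ) ^ 2 * fourArmProbAt t r₀ N := mul_nonneg (sq_nonneg _) hπ0
    calc rhombusPivotalSum t N ≤ CU * ((N : ℝ) ^ 2 * fourArmProbAt t r₀ N) := hu
      _ ≤ max CU 0 * ((N : ℝ) ^ 2 * fourArmProbAt t r₀ N) :=
          mul_le_mul_of_nonneg_right (le_max_left _ _) hX0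
      _ ≤ max CU 0 * ((N : ℝ) ^ 2 * (CS * critFourArmProb r₀ N)) :=
          mul_le_mul_of_nonneg_left (mul_le_mul_of_nonneg_left hst2 (sq_nonneg _)) (le_max_right _ _)
      _ = max CU 0 * CS * ((N : ℝ) ^ 2 * critFourArmProb r₀ N) := by ring

end Literature.Probability.Percolation
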